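import Literature.LinearAlgebra.Matrix.StarSubalgebraMatrixUnits
import HarnessLib

/-!
# A trace-preserving `*`-homomorphism `Φ : A → M_n(ℂ)` on a `ᴴ`-closed subalgebra `A ⊆ M_n(ℂ)` is `a ↦ u a uᴴ`

statement-level skeleton of published theorems with citation tags; proofs where landed; nothing here is a claim about
the Yang–Mills mass gap

Let `A ⊆ M_n(ℂ)` be a subalgebra closed under `ᴴ` and `Φ : A →ₐ[ℂ] M_n(ℂ)` an algebra homomorphism with
`tr Φ(a) = tr a` for all `a ∈ A`.  Then the two `A`-module structures on `ℂⁿ` — through the inclusion and through `Φ` —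
have the same character, hence (both being completely reducible) are ISOMORPHIC ([GoodmanWallachGTM255] Thm 4.1.19
«if V is completely reducible, then V is uniquely determined up to isomorphism by ch V»): there is an invertible `T`
with `T a = Φ(a) T` for all `a ∈ A` (`exists_intertwiner_of_trace_eq`).  We construct `T` EXPLICITLY from the matrix
units `E i s t` of `A` (`StarSubalgebraMatrixUnits.exists_matrixUnits`): `tr E i 0 0 = tr Φ(E i 0 0)` makes the ranges
of the idempotents `E i 0 0` and `Φ(E i 0 0)` equidimensional, a linear isomorphism `φ_i` between them is dressed to
`T_i`, and `T = Σ_{i,s} Φ(E i s 0) T_i E i 0 s`, `T⁻¹ = Σ_{i,s} E i s 0 T_i⁻¹ Φ(E i 0 s)`.  If moreover `Φ(aᴴ) = Φ(a)ᴴ`,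
the polar part of `T` does the same job UNITARILY (`exists_unitary_conj_eq_of_trace_eq`): `TᴴT` commutes with `A`, so
does its positive square root `R` (continuous functional calculus, `Commute.cfc_nnreal`), and `u = T R⁻¹` is a
unitary with `Φ(a) = u a uᴴ` — the standard unitarisation of an intertwiner between unitary representations
([Hall2015] proof of Prop. 4.? is the group version; here [folklore]).  Consequence used downstream
(`UnitarySimultaneousSimilarity`): finite-dimensional unitary representations with equal characters are unitarily
equivalent; unitary tuples with equal traces of all words are simultaneously unitarily similar (Specht–Wiegmann;
[Sengupta1994] Thm 2).
-/

open scoped ComplexOrder Matrix MatrixOrder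

namespace Literature.LinearAlgebra.Matrix

variable {n : Type*} [Fintype n] [DecidableEq n]

/-- For an IDEMPOTENT matrix the trace is the rank: `tr P = dim range P`. [folklore] -/
private theorem trace_eq_finrank_range_of_isIdempotentElem {P : Matrix n n ℂ} (hP : IsIdempotentElem P) :
    P.trace = (Module.finrank ℂ (LinearMap.range (Matrix.toLin' P)) : ℂ) := by
  rw [← Matrix.trace_toLin'_eq]
  have hP' : IsIdempotentElem (Matrix.toLin' P) := by
    change Matrix.toLin' P * Matrix.toLin' P = Matrix.toLin' P
    rw [Module.End.mul_eq_comp, ← Matrix.toLin'_mul, hP.eq]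
  exact (LinearMap.IsIdempotentElem.isProj_range _ hP').trace

/-- Idempotent matrices with equal traces have ranges of equal dimension. [folklore] -/
private theorem finrank_range_eq_of_isIdempotentElem_of_trace_eq {P Q : Matrix n n ℂ} (hP : IsIdempotentElem P)
    (hQ : IsIdempotentElem Q) (h : P.trace = Q.trace) :
    Module.finrank ℂ (LinearMap.range (Matrix.toLin' P)) = Module.finrank ℂ (LinearMap.range (Matrix.toLin' Q)) := by
  have := h
  rw [trace_eq_finrank_range_of_isIdempotentElem hP, trace_eq_finrank_range_of_isIdempotentElem hQ] at this
  exact_mod_cast this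

/-- Transport between the ranges of two idempotent matrices of equal trace: linear maps `L`, `L'` with
`L P = L`, `Q L = L`, `L' Q = L'`, `P L' = L'`, `L' L = P`, `L L' = Q` (a partial isometry-like pair built from a
linear isomorphism `range P ≃ range Q`, which exists because `tr P = dim range P`). [folklore] -/
private theorem exists_transport_of_isIdempotentElem {P Q : Matrix n n ℂ} (hP : IsIdempotentElem P)
    (hQ : IsIdempotentElem Q) (h : P.trace = Q.trace) :
    ∃ L L' : Matrix n n ℂ, L * P = L ∧ Q * L = L ∧ L' * Q = L' ∧ P * L' = L' ∧ L' * L = P ∧ L * L' = Q := by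
  set p := Matrix.toLin' P with hp
  set q := Matrix.toLin' Q with hq
  have hpp : p ∘ₗ p = p := by rw [hp, ← Matrix.toLin'_mul, hP.eq]
  have hqq : q ∘ₗ q = q := by rw [hq, ← Matrix.toLin'_mul, hQ.eq]
  have hpv : ∀ v, p (p v) = p v := fun v => LinearMap.congr_fun hpp v
  have hqv : ∀ v, q (q v) = q v := fun v => LinearMap.congr_fun hqq v
  have hpfix : ∀ y : LinearMap.range p, p y = y := by
    rintro ⟨y, ⟨v, rfl⟩⟩
    exact hpv v
  have hqfix : ∀ y : LinearMap.range q, q y = y := by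
    rintro ⟨y, ⟨v, rfl⟩⟩
    exact hqv v
  let φ : LinearMap.range p ≃ₗ[ℂ] LinearMap.range q :=
    LinearEquiv.ofFinrankEq _ _ (finrank_range_eq_of_isIdempotentElem_of_trace_eq hP hQ h)
  let L : (n → ℂ) →ₗ[ℂ] (n → ℂ) := (LinearMap.range q).subtype ∘ₗ φ.toLinearMap ∘ₗ p.rangeRestrict
  let L' : (n → ℂ) →ₗ[ℂ] (n → ℂ) := (LinearMap.range p).subtype ∘ₗ φ.symm.toLinearMap ∘ₗ q.rangeRestrict
  have hL : ∀ v, L v = ((φ (p.rangeRestrict v) : LinearMap.range q) : n → ℂ) := fun v => rfl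
  have hL' : ∀ v, L' v = ((φ.symm (q.rangeRestrict v) : LinearMap.range p) : n → ℂ) := fun v => rfl
  have h1 : L ∘ₗ p = L := by
    refine LinearMap.ext fun v => ?_
    change L (p v) = L v
    rw [hL, hL]
    have : p.rangeRestrict (p v) = p.rangeRestrict v := Subtype.ext (hpv v)
    rw [this]
  have h2 : q ∘ₗ L = L := by
    refine LinearMap.ext fun v => ?_
    change q (L v) = L v
    rw [hL]
    exact hqfix _
  have h3 : L' ∘ₗ q = L' := by
    refine LinearMap.ext fun v => ?_
    change L' (q v) = L' v
    rw [hL', hL']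
    have : q.rangeRestrict (q v) = q.rangeRestrict v := Subtype.ext (hqv v)
    rw [this]
  have h4 : p ∘ₗ L' = L' := by
    refine LinearMap.ext fun v => ?_
    change p (L' v) = L' v
    rw [hL']
    exact hpfix _
  have h5 : L' ∘ₗ L = p := by
    refine LinearMap.ext fun v => ?_
    change L' (L v) = p v
    rw [hL', hL]
    have : q.rangeRestrict ((φ (p.rangeRestrict v) : LinearMap.range q) : n → ℂ) = φ (p.rangeRestrict v) :=
      Subtype.ext (hqfix _)
    rw [this, LinearEquiv.symm_apply_apply]
    rfl
  have h6 : L ∘ₗ L' = q := by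
    refine LinearMap.ext fun v => ?_
    change L (L' v) = q v
    rw [hL, hL']
    have : p.rangeRestrict ((φ.symm (q.rangeRestrict v) : LinearMap.range p) : n → ℂ)
        = φ.symm (q.rangeRestrict v) :=
      Subtype.ext (hpfix _)
    rw [this, LinearEquiv.apply_symm_apply]
    rfl
  refine ⟨LinearMap.toMatrix' L, LinearMap.toMatrix' L', ?_, ?_, ?_, ?_, ?_, ?_⟩
  · have := congrArg LinearMap.toMatrix' h1
    rwa [LinearMap.toMatrix'_comp, hp, LinearMap.toMatrix'_toLin'] at this
  · have := congrArg LinearMap.toMatrix' h2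
    rwa [LinearMap.toMatrix'_comp, hq, LinearMap.toMatrix'_toLin'] at this
  · have := congrArg LinearMap.toMatrix' h3
    rwa [LinearMap.toMatrix'_comp, hq, LinearMap.toMatrix'_toLin'] at this
  · have := congrArg LinearMap.toMatrix' h4
    rwa [LinearMap.toMatrix'_comp, hp, LinearMap.toMatrix'_toLin'] at this
  · have := congrArg LinearMap.toMatrix' h5
    rwa [LinearMap.toMatrix'_comp, hp, LinearMap.toMatrix'_toLin'] at this
  · have := congrArg LinearMap.toMatrix' h6
    rwa [LinearMap.toMatrix'_comp, hq, LinearMap.toMatrix'_toLin'] at this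

/-- **Equal characters ⇒ isomorphic modules** ([GoodmanWallachGTM255] Thm 4.1.19, for the completely reducible
`A`-modules `ℂⁿ` (inclusion) and `ℂⁿ` (through `Φ`)): if `Φ : A →ₐ[ℂ] M_n(ℂ)` preserves traces on a `ᴴ`-closed
subalgebra `A ⊆ M_n(ℂ)`, there is an INVERTIBLE `T` with `T a = Φ(a) T` for every `a ∈ A`.  Constructed explicitly on
matrix units. [cite: GoodmanWallachGTM255, §4.1.7 Thm 4.1.19] -/
theorem exists_intertwiner_of_trace_eq (A : Subalgebra ℂ (Matrix n n ℂ)) (hA : ∀ a ∈ A, aᴴ ∈ A)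
    (Φ : A →ₐ[ℂ] Matrix n n ℂ) (htr : ∀ a : A, (Φ a).trace = (a : Matrix n n ℂ).trace) :
    ∃ T T' : Matrix n n ℂ, T' * T = 1 ∧ T * T' = 1 ∧ ∀ a : A, T * a = Φ a * T := by
  obtain ⟨m, d, E, hd, hmem, hmul, hmul', hsum, hspan⟩ := exists_matrixUnits A hA
  -- the units as elements of `A`, and their images under `Φ`
  let Ea : (i : Fin m) → Fin (d i) → Fin (d i) → A := fun i s t => ⟨E i s t, hmem i s t⟩
  let F : (i : Fin m) → Fin (d i) → Fin (d i) → Matrix n n ℂ := fun i s t => Φ (Ea i s t)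
  have hEa_mul : ∀ i (s t u v : Fin (d i)), Ea i s t * Ea i u v = if t = u then Ea i s v else 0 := by
    intro i s t u v
    by_cases h : t = u
    · rw [if_pos h]
      exact Subtype.ext (by simp [Ea, hmul, h])
    · rw [if_neg h]
      exact Subtype.ext (by simp [Ea, hmul, h])
  have hEa_mul' : ∀ i j, i ≠ j → ∀ (s t : Fin (d i)) (u v : Fin (d j)), Ea i s t * Ea j u v = 0 := by
    intro i j hij s t u v
    exact Subtype.ext (by simp [Ea, hmul' i j hij])
  have hF_mul : ∀ i (s t u v : Fin (d i)), F i s t * F i u v = if t = u then F i s v else 0 := by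
    intro i s t u v
    simp only [F, ← map_mul, hEa_mul]
    split_ifs <;> simp
  have hF_mul' : ∀ i j, i ≠ j → ∀ (s t : Fin (d i)) (u v : Fin (d j)), F i s t * F j u v = 0 := by
    intro i j hij s t u v
    simp only [F, ← map_mul, hEa_mul' i j hij s t u v, map_zero]
  have hEa_sum : (∑ i, ∑ s, Ea i s s) = 1 := Subtype.ext (by simpa [Ea] using hsum)
  have hF_sum : ∑ i, ∑ s, F i s s = 1 := by
    simp only [F, ← map_sum]
    rw [hEa_sum, map_one]
  -- base index in each block, the idempotents `P i = E i 0 0`, `Q i = Φ(P i)` and the transports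
  let z : (i : Fin m) → Fin (d i) := fun i => ⟨0, hd i⟩
  have hPidem : ∀ i, IsIdempotentElem (E i (z i) (z i)) := fun i => by
    change E i (z i) (z i) * E i (z i) (z i) = E i (z i) (z i)
    rw [hmul, if_pos rfl]
  have hQidem : ∀ i, IsIdempotentElem (F i (z i) (z i)) := fun i => by
    change F i (z i) (z i) * F i (z i) (z i) = F i (z i) (z i)
    rw [hF_mul, if_pos rfl]
  have htrPQ : ∀ i, (E i (z i) (z i)).trace = (F i (z i) (z i)).trace := fun i => (htr (Ea i (z i) (z i))).symm
  choose L L' hLP hQL hL'Q hPL' hL'L hLL' using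
    fun i => exists_transport_of_isIdempotentElem (hPidem i) (hQidem i) (htrPQ i)
  -- the intertwiner and its inverse, as sums over the index type `σ = Σ i, Fin (d i)`
  let X : (Σ i, Fin (d i)) → Matrix n n ℂ := fun p => F p.1 p.2 (z p.1) * L p.1 * E p.1 (z p.1) p.2
  let Y : (Σ i, Fin (d i)) → Matrix n n ℂ := fun p => E p.1 p.2 (z p.1) * L' p.1 * F p.1 (z p.1) p.2
  -- products of the summands
  have hYX : ∀ p q : (Σ i, Fin (d i)), Y p * X q = if p = q then E p.1 p.2 p.2 else 0 := by
    rintro ⟨i, s⟩ ⟨j, t⟩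
    by_cases hij : i = j
    · subst hij
      by_cases hst : s = t
      · subst hst
        rw [if_pos rfl]
        calc Y ⟨i, s⟩ * X ⟨i, s⟩
            = E i s (z i) * L' i * (F i (z i) s * F i s (z i)) * L i * E i (z i) s := by
              simp only [X, Y, Matrix.mul_assoc]
          _ = E i s (z i) * (L' i * L i) * E i (z i) s := by
              rw [hF_mul, if_pos rfl, Matrix.mul_assoc (E i s (z i) * L' i), hQL, Matrix.mul_assoc (E i s (z i))]
          _ = E i s s := by
              rw [hL'L, hmul, if_pos rfl, hmul, if_pos rfl]
      · rw [if_neg (fun h => hst (by cases h; rfl))]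
        calc Y ⟨i, s⟩ * X ⟨i, t⟩
            = E i s (z i) * L' i * (F i (z i) s * F i t (z i)) * L i * E i (z i) t := by
              simp only [X, Y, Matrix.mul_assoc]
          _ = 0 := by rw [hF_mul, if_neg hst]; simp
    · rw [if_neg (fun h => hij (congrArg Sigma.fst h))]
      calc Y ⟨i, s⟩ * X ⟨j, t⟩
          = E i s (z i) * L' i * (F i (z i) s * F j t (z j)) * L j * E j (z j) t := by
            simp only [X, Y, Matrix.mul_assoc]
        _ = 0 := by rw [hF_mul' i j hij]; simp
  have hXY : ∀ p q : (Σ i, Fin (d i)), X p * Y q = if p = q then F p.1 p.2 p.2 else 0 := by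
    rintro ⟨i, s⟩ ⟨j, t⟩
    by_cases hij : i = j
    · subst hij
      by_cases hst : s = t
      · subst hst
        rw [if_pos rfl]
        calc X ⟨i, s⟩ * Y ⟨i, s⟩
            = F i s (z i) * L i * (E i (z i) s * E i s (z i)) * L' i * F i (z i) s := by
              simp only [X, Y, Matrix.mul_assoc]
          _ = F i s (z i) * (L i * L' i) * F i (z i) s := by
              rw [hmul, if_pos rfl, Matrix.mul_assoc (F i s (z i) * L i), hPL', Matrix.mul_assoc (F i s (z i))]
          _ = F i s s := by
              rw [hLL', hF_mul, if_pos rfl, hF_mul, if_pos rfl]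
      · rw [if_neg (fun h => hst (by cases h; rfl))]
        calc X ⟨i, s⟩ * Y ⟨i, t⟩
            = F i s (z i) * L i * (E i (z i) s * E i t (z i)) * L' i * F i (z i) t := by
              simp only [X, Y, Matrix.mul_assoc]
          _ = 0 := by rw [hmul, if_neg hst]; simp
    · rw [if_neg (fun h => hij (congrArg Sigma.fst h))]
      calc X ⟨i, s⟩ * Y ⟨j, t⟩
          = F i s (z i) * L i * (E i (z i) s * E j t (z j)) * L' j * F j (z j) t := by
            simp only [X, Y, Matrix.mul_assoc]
        _ = 0 := by rw [hmul' i j hij]; simp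
  -- products of a summand with a matrix unit, resp. its image
  have hXE : ∀ (p : Σ i, Fin (d i)) (j : Fin m) (t u : Fin (d j)),
      X p * E j t u = if p = ⟨j, t⟩ then F j t (z j) * L j * E j (z j) u else 0 := by
    rintro ⟨i, s⟩ j t u
    by_cases hij : i = j
    · subst hij
      by_cases hst : s = t
      · subst hst
        rw [if_pos rfl]
        simp only [X, Matrix.mul_assoc, hmul, if_true]
      · rw [if_neg (fun h => hst (by cases h; rfl))]
        simp only [X, Matrix.mul_assoc, hmul, if_neg hst, Matrix.mul_zero]
    · rw [if_neg (fun h => hij (congrArg Sigma.fst h))]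
      simp only [X, Matrix.mul_assoc, hmul' i j hij, Matrix.mul_zero]
  have hFX : ∀ (p : Σ i, Fin (d i)) (j : Fin m) (t u : Fin (d j)),
      F j t u * X p = if p = ⟨j, u⟩ then F j t (z j) * L j * E j (z j) u else 0 := by
    rintro ⟨i, s⟩ j t u
    by_cases hij : i = j
    · subst hij
      by_cases hsu : s = u
      · subst hsu
        rw [if_pos rfl]
        simp only [X, ← Matrix.mul_assoc, hF_mul, if_true]
      · rw [if_neg (fun h => hsu (by cases h; rfl))]
        simp only [X, ← Matrix.mul_assoc, hF_mul, if_neg (Ne.symm hsu), Matrix.zero_mul]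
    · rw [if_neg (fun h => hij (congrArg Sigma.fst h))]
      simp only [X, ← Matrix.mul_assoc, hF_mul' j i (Ne.symm hij), Matrix.zero_mul]
  refine ⟨∑ p, X p, ∑ p, Y p, ?_, ?_, ?_⟩
  · -- `T' T = 1`
    rw [Finset.sum_mul_sum]
    simp_rw [hYX, Finset.sum_ite_eq, Finset.mem_univ, if_true]
    rw [← hsum, ← Finset.univ_sigma_univ, Finset.sum_sigma]
  · -- `T T' = 1`
    rw [Finset.sum_mul_sum]
    simp_rw [hXY, Finset.sum_ite_eq, Finset.mem_univ, if_true]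
    rw [← hF_sum, ← Finset.univ_sigma_univ, Finset.sum_sigma]
  · -- intertwining: first on the units, then by linearity
    have hunit : ∀ (j : Fin m) (t u : Fin (d j)), (∑ p, X p) * E j t u = F j t u * ∑ p, X p := by
      intro j t u
      rw [Finset.sum_mul, Finset.mul_sum]
      simp_rw [hXE, hFX, Finset.sum_ite_eq', Finset.mem_univ]
    intro a
    obtain ⟨c, hc⟩ := hspan a a.2
    have ha : a = ∑ i, ∑ s, ∑ t, c i s t • Ea i s t := Subtype.ext (by simpa [Ea] using hc)
    have hΦa : Φ a = ∑ i, ∑ s, ∑ t, c i s t • F i s t := by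
      rw [ha]
      simp only [map_sum, map_smul, F]
    rw [hΦa]
    conv_lhs => rw [hc]
    rw [Finset.mul_sum, Finset.sum_mul]
    refine Finset.sum_congr rfl fun i _ => ?_
    rw [Finset.mul_sum, Finset.sum_mul]
    refine Finset.sum_congr rfl fun s _ => ?_
    rw [Finset.mul_sum, Finset.sum_mul]
    refine Finset.sum_congr rfl fun t _ => ?_
    rw [Matrix.mul_smul, Matrix.smul_mul, hunit]

/-- **A trace-preserving `*`-homomorphism is unitarily implemented.**  If `A ⊆ M_n(ℂ)` is a `ᴴ`-closed subalgebra and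
`Φ : A →ₐ[ℂ] M_n(ℂ)` satisfies `Φ(aᴴ) = Φ(a)ᴴ` and `tr Φ(a) = tr a`, then there is a UNITARY `u` with
`Φ(a) = u a uᴴ` for all `a ∈ A`.  Proof: take the invertible intertwiner `T` of `exists_intertwiner_of_trace_eq`;
`TᴴT` commutes with `A`, hence so does `R = (TᴴT)^{1/2}` (continuous functional calculus), and `u = T R⁻¹` is unitary
and still intertwines — the standard unitarisation of an equivalence of unitary representations.  This is the
finite-dimensional `C⋆`-algebra fact behind Specht's theorem ([GoodmanWallachGTM255] Thm 4.1.19 gives the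
equivalence; the unitarisation step is [folklore]). [cite: GoodmanWallachGTM255, §4.1.7 Thm 4.1.19] -/
theorem exists_unitary_conj_eq_of_trace_eq (A : Subalgebra ℂ (Matrix n n ℂ)) (hA : ∀ a ∈ A, aᴴ ∈ A)
    (Φ : A →ₐ[ℂ] Matrix n n ℂ) (hstar : ∀ a : A, Φ ⟨(a : Matrix n n ℂ)ᴴ, hA _ a.2⟩ = (Φ a)ᴴ)
    (htr : ∀ a : A, (Φ a).trace = (a : Matrix n n ℂ).trace) :
    ∃ u : Matrix n n ℂ, u ∈ Matrix.unitaryGroup n ℂ ∧ ∀ a : A, Φ a = u * a * uᴴ := by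
  obtain ⟨T, T', hT'T, hTT', hTa⟩ := exists_intertwiner_of_trace_eq A hA Φ htr
  -- `Tᴴ Φ(a) = a Tᴴ`
  have hTha : ∀ a : A, Tᴴ * Φ a = a * Tᴴ := by
    intro a
    have h := hTa ⟨(a : Matrix n n ℂ)ᴴ, hA _ a.2⟩
    rw [hstar] at h
    have h' := congrArg Matrix.conjTranspose h
    simp only [Matrix.conjTranspose_mul, Matrix.conjTranspose_conjTranspose] at h'
    exact h'.symm
  -- `P = Tᴴ T` commutes with `A`
  have hPa : ∀ a : A, Commute (Tᴴ * T) (a : Matrix n n ℂ) := by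
    intro a
    change Tᴴ * T * a = a * (Tᴴ * T)
    rw [Matrix.mul_assoc, hTa, ← Matrix.mul_assoc, hTha, Matrix.mul_assoc]
  have hP0 : (0 : Matrix n n ℂ) ≤ Tᴴ * T :=
    Matrix.nonneg_iff_posSemidef.mpr (Matrix.posSemidef_conjTranspose_mul_self T)
  have hTdet : IsUnit T.det := Matrix.isUnit_det_of_left_inverse hT'T
  have hThdet : IsUnit Tᴴ.det := by
    refine Matrix.isUnit_det_of_left_inverse (B := T'ᴴ) ?_
    rw [← Matrix.conjTranspose_mul, hTT', Matrix.conjTranspose_one]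
  have hPunit : IsUnit (Tᴴ * T) :=
    ((Matrix.isUnit_iff_isUnit_det _).mpr hThdet).mul ((Matrix.isUnit_iff_isUnit_det _).mpr hTdet)
  -- the positive square root `R` of `P`
  set R : Matrix n n ℂ := CFC.sqrt (Tᴴ * T) with hRdef
  have hRR : R * R = Tᴴ * T := CFC.sqrt_mul_sqrt_self _ hP0
  have hRunit : IsUnit R := (CFC.isUnit_sqrt_iff _ hP0).mpr hPunit
  have hRdet : IsUnit R.det := (Matrix.isUnit_iff_isUnit_det R).mp hRunit
  have hRsa : Rᴴ = R := by
    have h := IsSelfAdjoint.of_nonneg (CFC.sqrt_nonneg (Tᴴ * T))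
    rwa [IsSelfAdjoint, Matrix.star_eq_conjTranspose] at h
  have hRa : ∀ a : A, Commute R (a : Matrix n n ℂ) := fun a => by
    rw [hRdef, CFC.sqrt_eq_cfc]
    exact (hPa a).cfc_nnreal _
  have hRinv_a : ∀ a : A, R⁻¹ * a = a * R⁻¹ := by
    intro a
    calc R⁻¹ * a = R⁻¹ * a * (R * R⁻¹) := by rw [Matrix.mul_nonsing_inv _ hRdet, Matrix.mul_one]
      _ = R⁻¹ * (R * a) * R⁻¹ := by rw [(hRa a).eq]; simp only [Matrix.mul_assoc]
      _ = a * R⁻¹ := by rw [← Matrix.mul_assoc, Matrix.nonsing_inv_mul _ hRdet, Matrix.one_mul]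
  -- the unitary `u = T R⁻¹`
  refine ⟨T * R⁻¹, ?_, ?_⟩
  · have hconj : (T * R⁻¹)ᴴ = R⁻¹ * Tᴴ := by
      rw [Matrix.conjTranspose_mul, Matrix.conjTranspose_nonsing_inv, hRsa]
    have h1 : (T * R⁻¹)ᴴ * (T * R⁻¹) = 1 := by
      rw [hconj]
      calc R⁻¹ * Tᴴ * (T * R⁻¹) = R⁻¹ * (Tᴴ * T) * R⁻¹ := by simp only [Matrix.mul_assoc]
        _ = (R⁻¹ * R) * (R * R⁻¹) := by rw [← hRR]; simp only [Matrix.mul_assoc]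
        _ = 1 := by rw [Matrix.nonsing_inv_mul _ hRdet, Matrix.mul_nonsing_inv _ hRdet, Matrix.mul_one]
    rw [Matrix.mem_unitaryGroup_iff, Matrix.star_eq_conjTranspose]
    exact mul_eq_one_comm.mp h1
  · intro a
    have hconj : (T * R⁻¹)ᴴ = R⁻¹ * Tᴴ := by
      rw [Matrix.conjTranspose_mul, Matrix.conjTranspose_nonsing_inv, hRsa]
    have huu : (T * R⁻¹) * (T * R⁻¹)ᴴ = 1 := by
      have h1 : (T * R⁻¹)ᴴ * (T * R⁻¹) = 1 := by
        rw [hconj]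
        calc R⁻¹ * Tᴴ * (T * R⁻¹) = R⁻¹ * (Tᴴ * T) * R⁻¹ := by simp only [Matrix.mul_assoc]
          _ = (R⁻¹ * R) * (R * R⁻¹) := by rw [← hRR]; simp only [Matrix.mul_assoc]
          _ = 1 := by rw [Matrix.nonsing_inv_mul _ hRdet, Matrix.mul_nonsing_inv _ hRdet, Matrix.mul_one]
      exact mul_eq_one_comm.mp h1
    have hua : T * R⁻¹ * a = Φ a * (T * R⁻¹) := by
      rw [Matrix.mul_assoc, hRinv_a, ← Matrix.mul_assoc, hTa, Matrix.mul_assoc]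
    calc Φ a = Φ a * ((T * R⁻¹) * (T * R⁻¹)ᴴ) := by rw [huu, Matrix.mul_one]
      _ = (Φ a * (T * R⁻¹)) * (T * R⁻¹)ᴴ := by simp only [Matrix.mul_assoc]
      _ = T * R⁻¹ * a * (T * R⁻¹)ᴴ := by rw [← hua]

end Literature.LinearAlgebra.Matrix
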